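import Summits.BirchSwinnertonDyer.Rank1Residual.X2.HidaLimitCongruenceAlgebra
import Mathlib.RingTheory.PowerSeries.WeierstrassPreparation
import HarnessLib

set_option linter.dupNamespace false -- `Summit.BirchSwinnertonDyer.BirchSwinnertonDyer.Theorems.…` (summit = sub)
set_option autoImplicit false

/-!
# Route `CongruentShaFreeCut` (rung S2) — infrastructure for LEMMA R∞: `R₀ = 𝒪(\widehat{ℚ_p^ur})` is
# `(p)`-adically complete, and every non-zero `L ∈ R₀⟦T⟧` is `p^μ · L₀` with `L₀` of non-zero reduction
# (so that Mathlib's Weierstrass preparation applies to `L₀`)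

Cell `bsd-cn100`, prover seat `bsd-cn100-transfer` (g11), plan g15 RULING-4 (2026-08-27T01:22:06Z)
«COMMISSIONED … LEMMA R∞ (series rigidity across periods)», file 1: the two ring-theoretic inputs the
Weierstrass-preparation proof of R∞ needs about the receptacle `R₀ = unrIntegers p`
(`Literature.NumberTheory.EllipticCurves.unrIntegers`; a discrete valuation ring with uniformiser `p` —
tree theorems `…X2.HidaLimitAlgebra.isDiscreteValuationRing_unrIntegers` / `irreducible_natCast_p` /
`exists_associated_pow_natCast_p`). Supports, does not close, stmt-BirchSwinnertonDyer-19079. THEOREMS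
ONLY (no definition, no instance, no named fact, no `sorry`); imports no `Theses` module. PARTITION: none —
RANK axis. HONEST FRAMING: commutative algebra; nothing about BSD.

* §1 `norm_le_of_mem_span_pow`, `mem_span_pow_of_norm_le` — in `R₀`, `x ∈ (p^n)` iff `‖x‖ ≤ p^{-n}`
  (tree `R1.div_pow_mem_unrIntegers`); `maximalIdeal_eq_span_p` (under the DVR structure).
* §2 **`isAdicComplete_span_p`** — `R₀` is `(p)`-adically complete (`IsAdicComplete (span {p}) R₀`):
  Hausdorff (`‖x‖ ≤ p^{-n}` for all `n` forces `x = 0`) and precomplete (a coherent sequence is Cauchy in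
  `ℂ_p`; its limit lies in the CLOSED subring `R₀` and is the sought element) — the argument of Mathlib's
  instance for `ℤ_[p]`; **`isAdicComplete_maximalIdeal`** — the same for the maximal ideal.
* §3 **`UnrSeries.exists_eq_C_pow_mul_map_residue_ne_zero`** — `p`-content extraction in `R₀⟦T⟧`: every
  `L ≠ 0` is `C (p^μ) * L₀` with `L₀.map (residue R₀) ≠ 0` (port of the tree's `ℤ_p` version
  `IwasawaAlgebra.exists_eq_C_pow_mul_and_map_residue_ne_zero`).

References: [Washington1997] §7.1 (Weierstrass preparation over complete local rings); [SerreLocalFields1979]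
Ch. II §5 (`𝒪(\widehat{K^ur})`).
-/

noncomputable section

open scoped Classical Topology

open Filter PowerSeries Literature.NumberTheory.EllipticCurves
  Summit.BirchSwinnertonDyer.Rank1Residual.X2.HidaLimitAlgebra

namespace Summit.BirchSwinnertonDyer.BirchSwinnertonDyer.Theorems.CongruentShaFreeCutUnrSeriesWeierstrass

variable {p : ℕ} [hp : Fact p.Prime]

/-! ### §1 Norm versus divisibility by `p^n` in `R₀` -/

/-- The element `(p : R₀)^n` read in `ℂ_p` is `p^n`. [folklore] -/
theorem coe_natCast_pow (n : ℕ) :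
    ((((p : ℕ) : unrIntegers p) ^ n : unrIntegers p) : ℂ_[p]) = (p : ℂ_[p]) ^ n := by
  push_cast
  rfl

/-- `‖p^n‖ = p^{-n}` in `ℂ_p`, read on the element `(p : R₀)^n`. [folklore] -/
theorem norm_coe_natCast_pow (n : ℕ) :
    ‖((((p : ℕ) : unrIntegers p) ^ n : unrIntegers p) : ℂ_[p])‖ = ((p : ℝ)⁻¹) ^ n := by
  rw [coe_natCast_pow, norm_pow, Literature.NumberTheory.LFunctions.Dwork.norm_natCast_p_padicComplex]

/-- If `x ∈ (p^n) ⊂ R₀` then `‖x‖ ≤ p^{-n}` (`‖R₀‖ ≤ 1`). [folklore] -/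
theorem norm_le_of_mem_span_pow {x : unrIntegers p} {n : ℕ}
    (hx : x ∈ Ideal.span {(((p : ℕ) : unrIntegers p) ^ n : unrIntegers p)}) :
    ‖(x : ℂ_[p])‖ ≤ ((p : ℝ)⁻¹) ^ n := by
  obtain ⟨y, rfl⟩ := Ideal.mem_span_singleton'.mp hx
  rw [Subring.coe_mul, norm_mul, norm_coe_natCast_pow]
  calc ‖(y : ℂ_[p])‖ * ((p : ℝ)⁻¹) ^ n ≤ 1 * ((p : ℝ)⁻¹) ^ n := by
        gcongr
        exact Summit.BirchSwinnertonDyer.Rank1Residual.X11b.Halves.norm_coe_unrIntegers_le_one p y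
    _ = ((p : ℝ)⁻¹) ^ n := one_mul _

/-- Conversely, if `‖x‖ ≤ p^{-n}` then `x ∈ (p^n)`: `x / p^n ∈ R₀` (tree `R1.div_pow_mem_unrIntegers`).
[folklore] -/
theorem mem_span_pow_of_norm_le {x : unrIntegers p} {n : ℕ} (hx : ‖(x : ℂ_[p])‖ ≤ ((p : ℝ)⁻¹) ^ n) :
    x ∈ Ideal.span {(((p : ℕ) : unrIntegers p) ^ n : unrIntegers p)} := by
  have hp0 : (p : ℂ_[p]) ≠ 0 := by exact_mod_cast hp.out.ne_zero
  have hmem := Summit.BirchSwinnertonDyer.Rank1Residual.X11b.R1.div_pow_mem_unrIntegers x.2 hx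
  rw [Ideal.mem_span_singleton']
  refine ⟨⟨(x : ℂ_[p]) / (p : ℂ_[p]) ^ n, hmem⟩, Subtype.ext ?_⟩
  rw [Subring.coe_mul, coe_natCast_pow, Subtype.coe_mk]
  exact div_mul_cancel₀ _ (pow_ne_zero _ hp0)

/-- `x ∈ (p^n)` iff `‖x‖ ≤ p^{-n}`, for `x ∈ R₀`. [folklore] -/
theorem mem_span_pow_iff_norm_le {x : unrIntegers p} {n : ℕ} :
    x ∈ Ideal.span {(((p : ℕ) : unrIntegers p) ^ n : unrIntegers p)} ↔
      ‖(x : ℂ_[p])‖ ≤ ((p : ℝ)⁻¹) ^ n :=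
  ⟨norm_le_of_mem_span_pow, mem_span_pow_of_norm_le⟩

/-- Under the DVR structure of `R₀` (tree `isDiscreteValuationRing_unrIntegers`, used via `haveI`), the
maximal ideal is `(p)`. [cite: SerreLocalFields1979, Ch. II §5, Thm. 3] -/
theorem maximalIdeal_eq_span_p :
    (haveI := isDiscreteValuationRing_unrIntegers (p := p); IsLocalRing.maximalIdeal (unrIntegers p)) =
      Ideal.span {((p : ℕ) : unrIntegers p)} := by
  haveI := isDiscreteValuationRing_unrIntegers (p := p)
  exact (IsDiscreteValuationRing.irreducible_iff_uniformizer _).mp irreducible_natCast_p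

/-! ### §2 `R₀` is `(p)`-adically complete -/

/-- **`R₀` is `(p)`-adically complete**: Hausdorff because `‖x‖ ≤ p^{-n}` for all `n` forces `x = 0`, and
precomplete because a `(p)`-adically coherent sequence is Cauchy in the complete field `ℂ_p` and its
limit lies in the CLOSED subring `R₀` (`isClosed_unrIntegers`) at distance `≤ p^{-n}` from the `n`-th term
(the argument of Mathlib's instance `IsAdicComplete (maximalIdeal ℤ_[p]) ℤ_[p]`).
[cite: SerreLocalFields1979, Ch. II §5, Thm. 3] -/
theorem isAdicComplete_span_p :
    IsAdicComplete (Ideal.span {((p : ℕ) : unrIntegers p)}) (unrIntegers p) := by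
  have hp' : p.Prime := hp.out
  have hpinv0 : (0 : ℝ) ≤ (p : ℝ)⁻¹ := inv_nonneg.mpr (by exact_mod_cast hp'.pos.le)
  have hpinv1 : (p : ℝ)⁻¹ < 1 := inv_lt_one_of_one_lt₀ (by exact_mod_cast hp'.one_lt)
  have hlim : Tendsto (fun n : ℕ ↦ ((p : ℝ)⁻¹) ^ n) atTop (𝓝 0) :=
    tendsto_pow_atTop_nhds_zero_of_lt_one hpinv0 hpinv1
  haveI hH : IsHausdorff (Ideal.span {((p : ℕ) : unrIntegers p)}) (unrIntegers p) := by
    refine ⟨fun x hx ↦ ?_⟩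
    simp only [← Ideal.one_eq_top, smul_eq_mul, mul_one, SModEq.sub_mem, sub_zero,
      Ideal.span_singleton_pow, mem_span_pow_iff_norm_le] at hx
    have h0 : ‖(x : ℂ_[p])‖ ≤ 0 :=
      ge_of_tendsto' hlim fun n ↦ hx n
    exact Subtype.ext (norm_le_zero_iff.mp h0)
  haveI hP : IsPrecomplete (Ideal.span {((p : ℕ) : unrIntegers p)}) (unrIntegers p) := by
    refine ⟨fun f hf ↦ ?_⟩
    simp only [← Ideal.one_eq_top, smul_eq_mul, mul_one, SModEq.sub_mem, Ideal.span_singleton_pow,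
      mem_span_pow_iff_norm_le] at hf ⊢
    -- the sequence is Cauchy in `ℂ_p`
    have hdist : ∀ m n N : ℕ, N ≤ m → N ≤ n →
        dist ((f m : unrIntegers p) : ℂ_[p]) ((f n : unrIntegers p) : ℂ_[p]) ≤ ((p : ℝ)⁻¹) ^ N := by
      intro m n N hm hn
      rw [dist_eq_norm]
      rcases le_total m n with hmn | hnm
      · calc ‖((f m : unrIntegers p) : ℂ_[p]) - (f n : ℂ_[p])‖
            = ‖((f m - f n : unrIntegers p) : ℂ_[p])‖ := by rw [AddSubgroupClass.coe_sub]
          _ ≤ ((p : ℝ)⁻¹) ^ m := hf hmn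
          _ ≤ ((p : ℝ)⁻¹) ^ N := pow_le_pow_of_le_one hpinv0 hpinv1.le hm
      · calc ‖((f m : unrIntegers p) : ℂ_[p]) - (f n : ℂ_[p])‖
            = ‖((f n - f m : unrIntegers p) : ℂ_[p])‖ := by rw [AddSubgroupClass.coe_sub, norm_sub_rev]
          _ ≤ ((p : ℝ)⁻¹) ^ n := hf hnm
          _ ≤ ((p : ℝ)⁻¹) ^ N := pow_le_pow_of_le_one hpinv0 hpinv1.le hn
    have hcau : CauchySeq (fun n ↦ ((f n : unrIntegers p) : ℂ_[p])) :=
      cauchySeq_of_le_tendsto_0 (fun N ↦ ((p : ℝ)⁻¹) ^ N) hdist hlim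
    obtain ⟨ℓ, hℓ⟩ := cauchySeq_tendsto_of_complete hcau
    have hℓmem : ℓ ∈ unrIntegers p :=
      isClosed_unrIntegers.mem_of_tendsto hℓ (Eventually.of_forall fun n ↦ (f n).2)
    refine ⟨⟨ℓ, hℓmem⟩, fun n ↦ ?_⟩
    -- `‖f n - ℓ‖ ≤ p^{-n}`: the limit of `‖f n - f m‖ ≤ p^{-n}` as `m → ∞`
    have hten : Tendsto (fun m ↦ ‖((f n : unrIntegers p) : ℂ_[p]) - (f m : ℂ_[p])‖) atTop
        (𝓝 ‖((f n : unrIntegers p) : ℂ_[p]) - ℓ‖) :=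
      (tendsto_const_nhds.sub hℓ).norm
    have hev : ∀ᶠ m in atTop, ‖((f n : unrIntegers p) : ℂ_[p]) - (f m : ℂ_[p])‖ ≤ ((p : ℝ)⁻¹) ^ n := by
      filter_upwards [eventually_ge_atTop n] with m hm
      have := hdist n m n le_rfl hm
      rwa [dist_eq_norm] at this
    have key : ‖((f n : unrIntegers p) : ℂ_[p]) - ℓ‖ ≤ ((p : ℝ)⁻¹) ^ n := le_of_tendsto hten hev
    simpa [AddSubgroupClass.coe_sub] using key
  exact ⟨⟩

/-- **`R₀` is adically complete for its maximal ideal** (= `(p)`), under the DVR structure of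
`isDiscreteValuationRing_unrIntegers` (`haveI`): the hypothesis of Mathlib's Weierstrass preparation for
`R₀⟦T⟧`. [cite: Washington1997, §7.1 (Thm. 7.3)] -/
theorem isAdicComplete_maximalIdeal :
    (haveI := isDiscreteValuationRing_unrIntegers (p := p);
      IsAdicComplete (IsLocalRing.maximalIdeal (unrIntegers p)) (unrIntegers p)) := by
  haveI := isDiscreteValuationRing_unrIntegers (p := p)
  rw [show IsLocalRing.maximalIdeal (unrIntegers p) = Ideal.span {((p : ℕ) : unrIntegers p)} from
    maximalIdeal_eq_span_p]
  exact isAdicComplete_span_p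

/-! ### §3 `p`-content extraction in `R₀⟦T⟧` -/

/-- A non-zero element of `R₀` is not divisible by arbitrarily high powers of `p` (`x = p^n·unit`).
[folklore] -/
theorem exists_not_pow_succ_dvd {x : unrIntegers p} (hx : x ≠ 0) :
    ∃ k : ℕ, ¬ ((p : ℕ) : unrIntegers p) ^ (k + 1) ∣ x := by
  obtain ⟨n, u, hu⟩ := exists_associated_pow_natCast_p hx
  refine ⟨n, fun ⟨c, hc⟩ ↦ ?_⟩
  have hirr := irreducible_natCast_p (p := p)
  apply hirr.not_isUnit
  -- `p^n · u = p^(n+1) · c` forces `u = p · c`, so `p` divides a unit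
  have hp0 : (((p : ℕ) : unrIntegers p) ^ n : unrIntegers p) ≠ 0 := pow_ne_zero _ hirr.ne_zero
  have h1 : ((p : ℕ) : unrIntegers p) ^ n * (u : unrIntegers p) =
      ((p : ℕ) : unrIntegers p) ^ n * (((p : ℕ) : unrIntegers p) * c) := by
    rw [hu, hc, pow_succ, mul_assoc]
  have h2 : (u : unrIntegers p) = ((p : ℕ) : unrIntegers p) * c := mul_left_cancel₀ hp0 h1
  exact isUnit_of_mul_isUnit_left (h2 ▸ Units.isUnit u)

/-- **`p`-content extraction in `Λ^nr = R₀⟦T⟧`**: every non-zero `L ∈ R₀⟦T⟧` is `C (p^μ) * L₀` with `L₀` of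
NON-ZERO reduction modulo the maximal ideal `(p)` of `R₀` (so that Weierstrass preparation applies to
`L₀`). `μ` = the minimal `p`-adic valuation of the coefficients. Port of the tree's
`IwasawaAlgebra.exists_eq_C_pow_mul_and_map_residue_ne_zero` (`ℤ_p` coefficients). [cite: Washington1997, §7.1 (Lemma 7.5 ff.: μ-invariant)] -/
theorem UnrSeries.exists_eq_C_pow_mul_map_residue_ne_zero {L : UnrSeries p} (hL : L ≠ 0) :
    ∃ (μ : ℕ) (L₀ : UnrSeries p), L = PowerSeries.C (((p : ℕ) : unrIntegers p) ^ μ) * L₀ ∧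
      (haveI := isDiscreteValuationRing_unrIntegers (p := p);
        L₀.map (IsLocalRing.residue (unrIntegers p)) ≠ 0) := by
  haveI := isDiscreteValuationRing_unrIntegers (p := p)
  have hex : ∃ m : ℕ, ∃ n, ¬ ((p : ℕ) : unrIntegers p) ^ (m + 1) ∣ PowerSeries.coeff n L := by
    obtain ⟨n, hn⟩ : ∃ n, PowerSeries.coeff n L ≠ 0 := by
      by_contra h
      push Not at h
      exact hL (PowerSeries.ext fun n ↦ by rw [h n, map_zero])
    obtain ⟨k, hk⟩ := exists_not_pow_succ_dvd hn
    exact ⟨k, n, hk⟩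
  let m := Nat.find hex
  have hdiv : ∀ n, ((p : ℕ) : unrIntegers p) ^ m ∣ PowerSeries.coeff n L := by
    intro n
    rcases Nat.eq_zero_or_eq_succ_pred m with h0 | hs
    · rw [h0, pow_zero]; exact one_dvd _
    · have := Nat.find_min hex (m := m - 1) (by omega)
      push Not at this
      rw [hs]; exact this n
  choose b hb using hdiv
  refine ⟨m, PowerSeries.mk b, ?_, ?_⟩
  · ext n
    rw [PowerSeries.coeff_C_mul, PowerSeries.coeff_mk, hb n]
  · obtain ⟨n, hn⟩ := Nat.find_spec hex
    intro h
    apply hn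
    have hres : IsLocalRing.residue (unrIntegers p) (b n) = 0 := by
      have := congrArg (PowerSeries.coeff n) h
      rwa [PowerSeries.coeff_map, PowerSeries.coeff_mk, map_zero] at this
    rw [IsLocalRing.residue_eq_zero_iff, maximalIdeal_eq_span_p, Ideal.mem_span_singleton] at hres
    obtain ⟨c, hc⟩ := hres
    change ¬ ((p : ℕ) : unrIntegers p) ^ (m + 1) ∣ PowerSeries.coeff n L at hn
    rw [hb n, hc]
    exact ⟨c, by rw [pow_succ]; ring⟩

end Summit.BirchSwinnertonDyer.BirchSwinnertonDyer.Theorems.CongruentShaFreeCutUnrSeriesWeierstrass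

end
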